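import Mathlib.Analysis.Matrix.Normed
import Mathlib.Analysis.Calculus.Deriv.Mul
import Mathlib.Analysis.Calculus.Deriv.Prod
import Mathlib.Analysis.Calculus.Deriv.Comp
import Mathlib.Analysis.Calculus.FDeriv.Mul
import Mathlib.Analysis.Calculus.ContDiff.Operations
import Mathlib.Analysis.Calculus.ContDiff.Deriv
import Mathlib.Data.Matrix.Basis
import Mathlib.LinearAlgebra.Matrix.NonsingularInverse
import Mathlib.Topology.Instances.Matrix
import Mathlib.Topology.Algebra.Module.FiniteDimension
import Literature.Analysis.ODE.GaussianBeamRiccati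
import Literature.Analysis.ODE.LinearGrowth
import HarnessLib

/-!
# The matrix Riccati equation of the Gaussian-beam phase: global existence, transport of the
# velocity, smoothness

Topic `Literature/Analysis/ODE` (namespace `Literature.Analysis.ODE.GaussianBeamRiccati`, the
grouping sub-namespace of `GaussianBeamRiccati.lean`). That file proves the algebraic–differential
mechanism of Sbierski's construction of the second derivatives of the phase of a Gaussian beam
(Anal. PDE 8 (2015), §3 = arXiv:1311.2477v2 §2.2, pp. 12–14, after Ralston 1982): along any
differentiable solution `(J, V)` of the Jacobi system `J̇ = Bᵀ J + C V`, `V̇ = −A J − B V` with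
`(J, V)(s₀) = (1, M₀)` which transports the velocity (`J x₀ = x`, `V x₀ = ξ`), `M := V J⁻¹` is a
symmetric solution of the matrix Riccati equation `0 = A + BM + MBᵀ + MCM + Ṁ`, compatible with the
first derivatives and with transported imaginary part (`riccati_of_jacobi`). It explicitly leaves
to "the application" the two remaining steps of the printed argument: the **existence** of `(J, V)`
("Since (2.15) is a linear ODE, we get […] a global solution", arXiv p. 13) and the **identification
of the transported velocity by uniqueness** ("Since two solutions of (2.15) that agree initially
are actually equal, we infer that `X̃_f(s) = σ̇(s)` for all `s`", (2.21)/(2.27)). This file supplies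
them, together with the smoothness of `M`, and bundles the construction into one existence
statement:

* `exists_jacobi` — global solutions of the Jacobi system on `ℝ` with arbitrary data, for
  continuous coefficients (from `Literature.Analysis.ODE.exists_solution_of_linearGrowth`;
  Lipschitz/linear-growth constant `‖Bᵀ‖ + ‖C‖ + ‖A‖ + ‖B‖`, bounded on compact time intervals);
* `jacobi_mulVec_eq` — if `(x, ξ)` is a vector solution of the same system with `M₀ x(0) = ξ(0)`,
  then `J(s) x(0) = x(s)` and `V(s) x(0) = ξ(s)` (uniqueness for the linear vector equation,
  Mathlib's `ODE_solution_unique_of_mem_Ioo` on every `(−S, S)`);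
* `contDiffOn_jacobi_nat`, `contDiffOn_jacobi`, `contDiffOn_mul_inv` — solutions are `C^∞` where
  the coefficients are (bootstrap), and so is `V J⁻¹` where `J` is invertible
  (`contDiffAt_ringInverse`); entrywise versions independent of the matrix norm
  (`contDiffOn_matrix_of_entries`, `contDiffOn_entry`, `hasDerivAt_entry`);
* `exists_riccati` — **the bundled construction**: for continuous real coefficient paths `A, B, C`
  on `ℝ` (`A`, `C` symmetric, entries real), a vector solution `(x, ξ)` of the same system with
  `x(s) ≠ 0`, and `M₀` symmetric with `M₀ x(0) = ξ(0)` whose imaginary part has kernel `ℂ x(0)`,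
  there is a global `M : ℝ → Mat_n(ℂ)` with `M(0) = M₀`, symmetric, solving the Riccati equation,
  `M(s) x(s) = ξ(s)`, `imForm (M s)` taking the values of `imForm M₀` (hence non-negative if
  `imForm M₀` is) with kernel `ℂ x(s)`, entrywise differentiable with the Riccati right-hand side,
  and with `C^∞` entries wherever the entries of `A, B, C` are `C^∞`.

Conventions are those of `GaussianBeamRiccati.lean`: complex matrices with the scoped
`Matrix.Norms.Operator` normed-algebra structure (whose uniformity is the product one), realness
as `X.map conj = X`, and its Hermitian form `imForm`. No Lorentzian geometry appears; in the
application (`Literature/Geometry/Lorentzian/`) the coefficients are the blocks of the Hessian of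
`H = ½ g⁻¹(ζ, ζ)` along a null bicharacteristic, possibly multiplied by a common positive function
(a reparametrisation), and `(x, ξ) = (γ̇, (dφ)˙)`.

## References

* J. Sbierski, *Characterisation of the energy of Gaussian beams on Lorentzian manifolds: with
  applications to black hole spacetimes*, Anal. PDE 8 (2015) 1379–1420, §3, (3.3), (3.9), (3.12);
  arXiv:1311.2477v2 §2.2, pp. 12–14 ((2.15), (2.21), (2.27)). [Sbierski2015]
* J. Ralston, *Gaussian beams and the propagation of singularities*, in: Studies in Partial
  Differential Equations, MAA Stud. Math. 23 (1982) 206–248, §2. [Ralston1982]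
-/

noncomputable section

open Set Filter Metric Matrix

open scoped Matrix.Norms.Operator ComplexConjugate Topology NNReal ContDiff

namespace Literature.Analysis.ODE

namespace GaussianBeamRiccati

variable {n : Type*} [Fintype n] [DecidableEq n]

/-! ### Derivatives of entries and of matrix–vector products -/

omit [DecidableEq n] in
/-- Derivative of `s ↦ J(s) z` for a fixed vector `z` (the map `X ↦ X z` is continuous linear).
[folklore] -/
theorem hasDerivAt_mulVec_const {J : ℝ → Matrix n n ℂ} {J' : Matrix n n ℂ} {t : ℝ}
    (h : HasDerivAt J J' t) (z : n → ℂ) : HasDerivAt (fun s ↦ J s *ᵥ z) (J' *ᵥ z) t := by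
  set L : Matrix n n ℂ →L[ℝ] (n → ℂ) := LinearMap.toContinuousLinearMap
    { toFun := fun X ↦ X *ᵥ z
      map_add' := fun X Y ↦ Matrix.add_mulVec X Y z
      map_smul' := fun c X ↦ by rw [Matrix.smul_mulVec, RingHom.id_apply] } with hL
  have h2 : HasDerivAt (fun s ↦ L (J s)) (L J') t := L.hasFDerivAt.comp_hasDerivAt t h
  exact h2

omit [DecidableEq n] in
/-- Entrywise derivatives from the matrix derivative (independent of the matrix norm chosen, the
entries being continuous linear functionals). [folklore] -/
theorem hasDerivAt_entry {J : ℝ → Matrix n n ℂ} {J' : Matrix n n ℂ} {t : ℝ}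
    (h : HasDerivAt J J' t) (i k : n) : HasDerivAt (fun s ↦ J s i k) (J' i k) t := by
  set L : Matrix n n ℂ →L[ℝ] ℂ := LinearMap.toContinuousLinearMap
    { toFun := fun X ↦ X i k
      map_add' := fun _ _ ↦ rfl
      map_smul' := fun _ _ ↦ rfl } with hL
  have h2 : HasDerivAt (fun s ↦ L (J s)) (L J') t := L.hasFDerivAt.comp_hasDerivAt t h
  exact h2

/-! ### Global solutions of the Jacobi system -/

/-- The coefficient bound `k(t) = ‖Bᵀ‖ + ‖C‖ + ‖A‖ + ‖B‖` of the Jacobi system is continuous for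
continuous coefficients. [folklore] -/
theorem continuous_jacobiBound {A B C : ℝ → Matrix n n ℂ} (hA : Continuous A) (hB : Continuous B)
    (hC : Continuous C) :
    Continuous fun t ↦ ‖(B t)ᵀ‖ + ‖C t‖ + ‖A t‖ + ‖B t‖ :=
  ((hB.matrix_transpose.norm.add hC.norm).add hA.norm).add hB.norm

/-- On every compact time interval the coefficient bound is bounded by a constant `K ≥ 0`. [folklore] -/
theorem exists_jacobiBound_le {A B C : ℝ → Matrix n n ℂ} (hA : Continuous A) (hB : Continuous B)
    (hC : Continuous C) (T : ℝ) :
    ∃ K : ℝ≥0, ∀ t ∈ Icc (-T) T, ‖(B t)ᵀ‖ + ‖C t‖ + ‖A t‖ + ‖B t‖ ≤ K := by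
  obtain ⟨K₀, hK₀⟩ := isCompact_Icc.exists_bound_of_continuousOn
    ((continuous_jacobiBound hA hB hC).continuousOn (s := Icc (-T) T))
  refine ⟨⟨max K₀ 0, le_max_right _ _⟩, fun t ht ↦ ?_⟩
  have h := hK₀ t ht
  rw [Real.norm_of_nonneg (by positivity)] at h
  exact h.trans (le_max_left _ _)

/-- **Global solutions of the Jacobi system** `J̇ = Bᵀ J + C V`, `V̇ = −A J − B V` on `ℝ` with
arbitrary data `(J(0), V(0))`, for continuous coefficients: the system is linear, with Lipschitz
and linear-growth constant `‖Bᵀ‖ + ‖C‖ + ‖A‖ + ‖B‖` bounded on compact time intervals, so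
`exists_solution_of_linearGrowth` applies (Sbierski, arXiv:1311.2477v2 §2.2, p. 13: "Since (2.15)
is a linear ODE, we get […] a global solution"). [cite: Sbierski2015, §3; arXiv v2 §2.2 p. 13] -/
theorem exists_jacobi {A B C : ℝ → Matrix n n ℂ} (hA : Continuous A) (hB : Continuous B)
    (hC : Continuous C) (J₀ V₀ : Matrix n n ℂ) :
    ∃ J V : ℝ → Matrix n n ℂ, J 0 = J₀ ∧ V 0 = V₀ ∧
      (∀ t, HasDerivAt J ((B t)ᵀ * J t + C t * V t) t) ∧
      (∀ t, HasDerivAt V (-(A t * J t) - B t * V t) t) := by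
  set F : ℝ → Matrix n n ℂ × Matrix n n ℂ → Matrix n n ℂ × Matrix n n ℂ :=
    fun t Y ↦ ((B t)ᵀ * Y.1 + C t * Y.2, -(A t * Y.1) - B t * Y.2) with hF
  -- the field is linear in `Y`
  have hlin : ∀ t Y Y', F t Y - F t Y' = F t (Y - Y') := by
    intro t Y Y'
    simp only [hF, Prod.fst_sub, Prod.snd_sub, Prod.mk_sub_mk, mul_sub]
    ext1 <;> noncomm_ring
  -- norm bound
  have hbound : ∀ t Y, ‖F t Y‖ ≤ (‖(B t)ᵀ‖ + ‖C t‖ + ‖A t‖ + ‖B t‖) * ‖Y‖ := by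
    intro t Y
    have hY1 : ‖Y.1‖ ≤ ‖Y‖ := norm_fst_le Y
    have hY2 : ‖Y.2‖ ≤ ‖Y‖ := norm_snd_le Y
    have n1 := norm_nonneg (B t)ᵀ
    have n2 := norm_nonneg (C t)
    have n3 := norm_nonneg (A t)
    have n4 := norm_nonneg (B t)
    rw [Prod.norm_def]
    refine max_le ?_ ?_
    · calc ‖(B t)ᵀ * Y.1 + C t * Y.2‖
          ≤ ‖(B t)ᵀ‖ * ‖Y.1‖ + ‖C t‖ * ‖Y.2‖ :=
            (norm_add_le _ _).trans (add_le_add (norm_mul_le _ _) (norm_mul_le _ _))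
        _ ≤ ‖(B t)ᵀ‖ * ‖Y‖ + ‖C t‖ * ‖Y‖ := by gcongr
        _ ≤ _ := by nlinarith [norm_nonneg Y]
    · calc ‖-(A t * Y.1) - B t * Y.2‖
          ≤ ‖A t‖ * ‖Y.1‖ + ‖B t‖ * ‖Y.2‖ := by
            refine (norm_sub_le _ _).trans (add_le_add ?_ (norm_mul_le _ _))
            rw [norm_neg]; exact norm_mul_le _ _
        _ ≤ ‖A t‖ * ‖Y‖ + ‖B t‖ * ‖Y‖ := by gcongr
        _ ≤ _ := by nlinarith [norm_nonneg Y]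
  have hK : ∀ T : ℝ, ∃ K : ℝ≥0, ∀ t ∈ Icc (-T) T,
      LipschitzWith K (F t) ∧ ∀ Y, ‖F t Y‖ ≤ K * ‖Y‖ := by
    intro T
    obtain ⟨K, hK⟩ := exists_jacobiBound_le hA hB hC T
    refine ⟨K, fun t ht ↦ ⟨LipschitzWith.of_dist_le_mul fun Y Y' ↦ ?_, fun Y ↦ ?_⟩⟩
    · rw [dist_eq_norm, dist_eq_norm, hlin]
      exact (hbound t _).trans (mul_le_mul_of_nonneg_right (hK t ht) (norm_nonneg _))
    · exact (hbound t Y).trans (mul_le_mul_of_nonneg_right (hK t ht) (norm_nonneg _))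
  have hcont : ∀ Y, Continuous fun t ↦ F t Y := by
    intro Y
    simp only [hF]
    exact ((hB.matrix_transpose.mul continuous_const).add (hC.mul continuous_const)).prodMk
      ((hA.mul continuous_const).neg.sub (hB.mul continuous_const))
  obtain ⟨α, hα0, hα⟩ := exists_solution_of_linearGrowth hK hcont (J₀, V₀)
  refine ⟨fun t ↦ (α t).1, fun t ↦ (α t).2, by simp [hα0], by simp [hα0], fun t ↦ ?_, fun t ↦ ?_⟩
  · have h := (ContinuousLinearMap.fst ℝ (Matrix n n ℂ) (Matrix n n ℂ)).hasFDerivAt.comp_hasDerivAt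
      t (hα t)
    exact h
  · have h := (ContinuousLinearMap.snd ℝ (Matrix n n ℂ) (Matrix n n ℂ)).hasFDerivAt.comp_hasDerivAt
      t (hα t)
    exact h

/-- **Transport of vector solutions by the matrix solution** (the identification by uniqueness
of arXiv:1311.2477v2 §2.2, (2.21)/(2.27): "Since two solutions of (2.15) that agree initially are
actually equal, we infer that `X̃_f(s) = σ̇(s)` for all `s`", projected: `J(s) γ̇(0) = γ̇(s)`,
`V(s) γ̇(0) = (dφ)˙(s)`). If `(J, V)` solves the Jacobi system on `ℝ` with `J(0) = 1`,
`V(0) = M₀`, and `(x, ξ)` is a vector solution of the same system with `M₀ x(0) = ξ(0)`, then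
`J(t) x(0) = x(t)` and `V(t) x(0) = ξ(t)` for all `t`. [cite: Sbierski2015, §3; arXiv v2 §2.2 (2.21), (2.27)] -/
theorem jacobi_mulVec_eq {A B C : ℝ → Matrix n n ℂ} (hA : Continuous A) (hB : Continuous B)
    (hC : Continuous C) {J V : ℝ → Matrix n n ℂ}
    (hJ : ∀ t, HasDerivAt J ((B t)ᵀ * J t + C t * V t) t)
    (hV : ∀ t, HasDerivAt V (-(A t * J t) - B t * V t) t)
    (hJ0 : J 0 = 1) {M₀ : Matrix n n ℂ} (hV0 : V 0 = M₀) {x ξ : ℝ → n → ℂ}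
    (hx : ∀ t, HasDerivAt x ((B t)ᵀ *ᵥ x t + C t *ᵥ ξ t) t)
    (hξ : ∀ t, HasDerivAt ξ (-(A t *ᵥ x t) - B t *ᵥ ξ t) t)
    (hM₀ : M₀ *ᵥ x 0 = ξ 0) (t : ℝ) :
    J t *ᵥ x 0 = x t ∧ V t *ᵥ x 0 = ξ t := by
  set z₀ : n → ℂ := x 0 with hz₀
  -- the vector field of the vector system
  set F : ℝ → (n → ℂ) × (n → ℂ) → (n → ℂ) × (n → ℂ) :=
    fun s w ↦ ((B s)ᵀ *ᵥ w.1 + C s *ᵥ w.2, -(A s *ᵥ w.1) - B s *ᵥ w.2) with hF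
  have hlin : ∀ s w w', F s w - F s w' = F s (w - w') := by
    intro s w w'
    simp only [hF, Prod.fst_sub, Prod.snd_sub, Prod.mk_sub_mk, Matrix.mulVec_sub]
    ext1 <;> abel
  have hbound : ∀ s w, ‖F s w‖ ≤ (‖(B s)ᵀ‖ + ‖C s‖ + ‖A s‖ + ‖B s‖) * ‖w‖ := by
    intro s w
    have hw1 : ‖w.1‖ ≤ ‖w‖ := norm_fst_le w
    have hw2 : ‖w.2‖ ≤ ‖w‖ := norm_snd_le w
    have n1 := norm_nonneg (B s)ᵀ
    have n2 := norm_nonneg (C s)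
    have n3 := norm_nonneg (A s)
    have n4 := norm_nonneg (B s)
    rw [Prod.norm_def]
    refine max_le ?_ ?_
    · calc ‖(B s)ᵀ *ᵥ w.1 + C s *ᵥ w.2‖
          ≤ ‖(B s)ᵀ‖ * ‖w.1‖ + ‖C s‖ * ‖w.2‖ :=
            (norm_add_le _ _).trans (add_le_add (Matrix.linfty_opNorm_mulVec _ _)
              (Matrix.linfty_opNorm_mulVec _ _))
        _ ≤ ‖(B s)ᵀ‖ * ‖w‖ + ‖C s‖ * ‖w‖ := by gcongr
        _ ≤ _ := by nlinarith [norm_nonneg w]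
    · calc ‖-(A s *ᵥ w.1) - B s *ᵥ w.2‖
          ≤ ‖A s‖ * ‖w.1‖ + ‖B s‖ * ‖w.2‖ := by
            refine (norm_sub_le _ _).trans (add_le_add ?_ (Matrix.linfty_opNorm_mulVec _ _))
            rw [norm_neg]; exact Matrix.linfty_opNorm_mulVec _ _
        _ ≤ ‖A s‖ * ‖w‖ + ‖B s‖ * ‖w‖ := by gcongr
        _ ≤ _ := by nlinarith [norm_nonneg w]
  -- the two solutions
  set wa : ℝ → (n → ℂ) × (n → ℂ) := fun s ↦ (J s *ᵥ z₀, V s *ᵥ z₀) with hwa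
  set wb : ℝ → (n → ℂ) × (n → ℂ) := fun s ↦ (x s, ξ s) with hwb
  have hwa_der : ∀ s, HasDerivAt wa (F s (wa s)) s := by
    intro s
    have h := (hasDerivAt_mulVec_const (hJ s) z₀).prodMk (hasDerivAt_mulVec_const (hV s) z₀)
    refine h.congr_deriv ?_
    simp only [hF, hwa, Matrix.add_mulVec, Matrix.sub_mulVec, Matrix.neg_mulVec,
      Matrix.mulVec_mulVec]
  have hwb_der : ∀ s, HasDerivAt wb (F s (wb s)) s := fun s ↦ by
    have h := (hx s).prodMk (hξ s)
    simpa only [hF, hwb] using h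
  have hw0 : wa 0 = wb 0 := by
    simp only [hwa, hwb, hJ0, hV0, Matrix.one_mulVec, hM₀]
    rfl
  -- uniqueness on every `(-S, S)`
  have key : ∀ S : ℝ, 0 < S → EqOn wa wb (Ioo (-S) S) := by
    intro S hS
    obtain ⟨K, hK⟩ := exists_jacobiBound_le hA hB hC S
    have hlip : ∀ s ∈ Ioo (-S) S, LipschitzOnWith K (F s) univ := by
      intro s hs
      refine LipschitzOnWith.of_dist_le_mul fun w _ w' _ ↦ ?_
      rw [dist_eq_norm, dist_eq_norm, hlin]
      exact (hbound s _).trans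
        (mul_le_mul_of_nonneg_right (hK s (Ioo_subset_Icc_self hs)) (norm_nonneg _))
    exact ODE_solution_unique_of_mem_Ioo (v := F) (s := fun _ ↦ univ) hlip
      (by constructor <;> linarith : (0 : ℝ) ∈ Ioo (-S) S)
      (fun s _ ↦ ⟨hwa_der s, mem_univ _⟩) (fun s _ ↦ ⟨hwb_der s, mem_univ _⟩) hw0
  have ht : t ∈ Ioo (-(|t| + 1)) (|t| + 1) := by
    constructor <;> cases abs_cases t <;> linarith
  have h := key (|t| + 1) (by positivity) ht
  simp only [hwa, hwb, Prod.mk.injEq] at h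
  exact h

/-! ### Smoothness of solutions of the Jacobi system -/

/-- An elementary matrix with entry `c` is the scalar `c` times the elementary matrix with entry
`1`. [folklore] -/
theorem single_eq_algebraMap_mul (i k : n) (c : ℂ) :
    Matrix.single i k c = algebraMap ℂ (Matrix n n ℂ) c * Matrix.single i k 1 := by
  rw [Algebra.algebraMap_eq_smul_one, smul_mul_assoc, Matrix.one_mul, Matrix.smul_single,
    smul_eq_mul, mul_one]

/-- **A matrix-valued function is `Cⁿ` if its entries are** (independent of the matrix norm:
`X = ∑ X_{ik} E_{ik}` with `c ↦ c · 1` continuous linear). [folklore] -/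
theorem contDiffOn_matrix_of_entries {X : ℝ → Matrix n n ℂ} {U : Set ℝ} {m : ℕ∞}
    (h : ∀ i k, ContDiffOn ℝ m (fun t ↦ X t i k) U) : ContDiffOn ℝ m X U := by
  set L : ℂ →L[ℝ] Matrix n n ℂ :=
    LinearMap.toContinuousLinearMap ((Algebra.linearMap ℂ (Matrix n n ℂ)).restrictScalars ℝ)
    with hL
  have hLapply : ∀ c : ℂ, L c = algebraMap ℂ (Matrix n n ℂ) c := fun c ↦ rfl
  have hX : X = fun t ↦ ∑ i, ∑ k, L (X t i k) * Matrix.single i k (1 : ℂ) := by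
    funext t
    conv_lhs => rw [Matrix.matrix_eq_sum_single (X t)]
    refine Finset.sum_congr rfl fun i _ ↦ Finset.sum_congr rfl fun k _ ↦ ?_
    rw [hLapply, single_eq_algebraMap_mul]
  rw [hX]
  refine ContDiffOn.sum fun i _ ↦ ContDiffOn.sum fun k _ ↦ ContDiffOn.mul ?_ contDiffOn_const
  exact L.contDiff.comp_contDiffOn (h i k)

omit [DecidableEq n] in
/-- **The entries of a `Cⁿ` matrix-valued function are `Cⁿ`.** [folklore] -/
theorem contDiffOn_entry {X : ℝ → Matrix n n ℂ} {U : Set ℝ} {m : ℕ∞} (h : ContDiffOn ℝ m X U)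
    (i k : n) : ContDiffOn ℝ m (fun t ↦ X t i k) U := by
  set L : Matrix n n ℂ →L[ℝ] ℂ := LinearMap.toContinuousLinearMap
    { toFun := fun X ↦ X i k
      map_add' := fun _ _ ↦ rfl
      map_smul' := fun _ _ ↦ rfl } with hL
  exact L.contDiff.comp_contDiffOn h

/-- The transpose of a matrix function with `Cⁿ` entries is `Cⁿ`. [folklore] -/
theorem contDiffOn_transpose_of_entries {X : ℝ → Matrix n n ℂ} {U : Set ℝ} {m : ℕ∞}
    (h : ∀ i k, ContDiffOn ℝ m (fun t ↦ X t i k) U) : ContDiffOn ℝ m (fun t ↦ (X t)ᵀ) U :=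
  contDiffOn_matrix_of_entries fun i k ↦ h k i

/-- **Solutions of the Jacobi system are `Cᵐ` where the coefficients have `C^∞` entries** (every
finite `m`; bootstrap: `(J, V) ∈ Cᵏ` makes the right-hand sides `Cᵏ`, hence `(J, V) ∈ Cᵏ⁺¹`).
[cite: Sbierski2015, §3; arXiv v2 §2.2 p. 13] -/
theorem contDiffOn_jacobi_nat {A B C : ℝ → Matrix n n ℂ} {J V : ℝ → Matrix n n ℂ}
    (hJ : ∀ t, HasDerivAt J ((B t)ᵀ * J t + C t * V t) t)
    (hV : ∀ t, HasDerivAt V (-(A t * J t) - B t * V t) t) {U : Set ℝ} (hU : IsOpen U)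
    (hA : ∀ i k, ContDiffOn ℝ ∞ (fun t ↦ A t i k) U) (hB : ∀ i k, ContDiffOn ℝ ∞ (fun t ↦ B t i k) U)
    (hC : ∀ i k, ContDiffOn ℝ ∞ (fun t ↦ C t i k) U) (m : ℕ) :
    ContDiffOn ℝ m J U ∧ ContDiffOn ℝ m V U := by
  have hdJ : ∀ t ∈ U, deriv J t = (B t)ᵀ * J t + C t * V t := fun t _ ↦ (hJ t).deriv
  have hdV : ∀ t ∈ U, deriv V t = -(A t * J t) - B t * V t := fun t _ ↦ (hV t).deriv
  have hdiffJ : DifferentiableOn ℝ J U := fun t _ ↦ (hJ t).differentiableAt.differentiableWithinAt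
  have hdiffV : DifferentiableOn ℝ V U := fun t _ ↦ (hV t).differentiableAt.differentiableWithinAt
  induction m with
  | zero => exact ⟨contDiffOn_zero.2 hdiffJ.continuousOn, contDiffOn_zero.2 hdiffV.continuousOn⟩
  | succ k ih =>
    have hAk : ContDiffOn ℝ k A U := (contDiffOn_matrix_of_entries hA).of_le (by exact_mod_cast le_top)
    have hBk : ContDiffOn ℝ k B U := (contDiffOn_matrix_of_entries hB).of_le (by exact_mod_cast le_top)
    have hBtk : ContDiffOn ℝ k (fun t ↦ (B t)ᵀ) U :=
      (contDiffOn_transpose_of_entries hB).of_le (by exact_mod_cast le_top)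
    have hCk : ContDiffOn ℝ k C U := (contDiffOn_matrix_of_entries hC).of_le (by exact_mod_cast le_top)
    have hk : ((k + 1 : ℕ) : WithTop ℕ∞) = (k : WithTop ℕ∞) + 1 := by push_cast; rfl
    constructor
    · rw [hk, contDiffOn_succ_iff_deriv_of_isOpen hU]
      refine ⟨hdiffJ, fun h ↦ absurd h (by exact_mod_cast WithTop.coe_ne_top), ?_⟩
      exact ((hBtk.mul ih.1).add (hCk.mul ih.2)).congr fun t ht ↦ hdJ t ht
    · rw [hk, contDiffOn_succ_iff_deriv_of_isOpen hU]
      refine ⟨hdiffV, fun h ↦ absurd h (by exact_mod_cast WithTop.coe_ne_top), ?_⟩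
      exact ((hAk.mul ih.1).neg.sub (hBk.mul ih.2)).congr fun t ht ↦ hdV t ht

/-- **Solutions of the Jacobi system are smooth where the coefficients are.**
[cite: Sbierski2015, §3; arXiv v2 §2.2 p. 13] -/
theorem contDiffOn_jacobi {A B C : ℝ → Matrix n n ℂ} {J V : ℝ → Matrix n n ℂ}
    (hJ : ∀ t, HasDerivAt J ((B t)ᵀ * J t + C t * V t) t)
    (hV : ∀ t, HasDerivAt V (-(A t * J t) - B t * V t) t) {U : Set ℝ} (hU : IsOpen U)
    (hA : ∀ i k, ContDiffOn ℝ ∞ (fun t ↦ A t i k) U) (hB : ∀ i k, ContDiffOn ℝ ∞ (fun t ↦ B t i k) U)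
    (hC : ∀ i k, ContDiffOn ℝ ∞ (fun t ↦ C t i k) U) :
    ContDiffOn ℝ ∞ J U ∧ ContDiffOn ℝ ∞ V U :=
  ⟨contDiffOn_infty.2 fun m ↦ (contDiffOn_jacobi_nat hJ hV hU hA hB hC m).1,
    contDiffOn_infty.2 fun m ↦ (contDiffOn_jacobi_nat hJ hV hU hA hB hC m).2⟩

/-- **`V J⁻¹` is smooth where the coefficients are and `J` is invertible** (inversion is smooth on
the units of the complete normed algebra `Mat_n(ℂ)`, `contDiffAt_ringInverse`). [folklore] -/
theorem contDiffOn_mul_inv {A B C : ℝ → Matrix n n ℂ} {J V : ℝ → Matrix n n ℂ}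
    (hJ : ∀ t, HasDerivAt J ((B t)ᵀ * J t + C t * V t) t)
    (hV : ∀ t, HasDerivAt V (-(A t * J t) - B t * V t) t) {U : Set ℝ} (hU : IsOpen U)
    (hA : ∀ i k, ContDiffOn ℝ ∞ (fun t ↦ A t i k) U) (hB : ∀ i k, ContDiffOn ℝ ∞ (fun t ↦ B t i k) U)
    (hC : ∀ i k, ContDiffOn ℝ ∞ (fun t ↦ C t i k) U) (hu : ∀ t ∈ U, IsUnit (J t).det) :
    ContDiffOn ℝ ∞ (fun t ↦ V t * (J t)⁻¹) U := by
  obtain ⟨hJs, hVs⟩ := contDiffOn_jacobi hJ hV hU hA hB hC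
  have hinv : ContDiffOn ℝ ∞ (fun t ↦ (J t)⁻¹) U := by
    intro t ht
    obtain ⟨u, hu'⟩ := (Matrix.isUnit_iff_isUnit_det _).2 (hu t ht)
    have h1 : ContDiffAt ℝ ∞ Ring.inverse (J t) := hu' ▸ contDiffAt_ringInverse ℝ u
    have h2 := h1.comp_contDiffWithinAt t (hJs t ht)
    have h3 : (fun s ↦ (J s)⁻¹) = Ring.inverse ∘ J :=
      funext fun s ↦ Matrix.nonsing_inv_eq_ringInverse (J s)
    rw [h3]
    exact h2
  exact hVs.mul hinv

/-! ### The bundled construction -/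

/-- **Global solution of the matrix Riccati equation of the Gaussian-beam phase, with the
velocity transported and the imaginary part controlled** (Sbierski, Anal. PDE 8 (2015), §3,
(3.3), (3.9), (3.12); arXiv:1311.2477v2 §2.2, pp. 12–14; Ralston 1982, §2). Let `A, B, C` be
continuous, entrywise real matrix paths on `ℝ` with `A`, `C` symmetric; let `(x, ξ)` be a vector
solution of `ẋ = Bᵀ x + C ξ`, `ξ̇ = −A x − B ξ` with `x(s) ≠ 0` for all `s` (in the source the
tangent `(γ̇, (dφ)˙)` of the null bicharacteristic, (2.20); a common positive factor in `A, B, C`,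
i.e. a reparametrisation, is allowed); and let `M₀` be symmetric with `M₀ x(0) = ξ(0)` and such
that the Hermitian form `imForm M₀` of its imaginary part vanishes only on `ℂ x(0)`. Then there is
`M : ℝ → Mat_n(ℂ)` with `M(0) = M₀` such that for every `s`: `M(s)` is symmetric; `M` solves the
Riccati equation `Ṁ = −A − BM − MBᵀ − MCM` at `s`; `M(s) x(s) = ξ(s)` (compatibility (2.21));
`imForm (M s)` takes the values of `imForm M₀` (so it is non-negative if `imForm M₀` is) and
vanishes only on `ℂ x(s)` ((3.3): "`Im M(s)` stays positive definite on a three dimensional subspace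
transversal to `γ̇(s)`"); the entries of `M` are differentiable with the entries of the Riccati
right-hand side as derivatives; and they are `C^∞` on every open set on which the entries of
`A, B, C` are. Proof: `(J, V)` global with data `(1, M₀)` (`exists_jacobi`), transport by
uniqueness (`jacobi_mulVec_eq`), then `GaussianBeamRiccati.riccati_of_jacobi` on `I = ℝ`, and
`contDiffOn_mul_inv`. [cite: Sbierski2015, §3 (3.3), (3.9), (3.12); arXiv v2 §2.2 pp. 12–14] -/
theorem exists_riccati {A B C : ℝ → Matrix n n ℂ} (hAc : Continuous A) (hBc : Continuous B)
    (hCc : Continuous C) (hA : ∀ s, (A s)ᵀ = A s) (hC : ∀ s, (C s)ᵀ = C s)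
    (hAr : ∀ s, (A s).map conj = A s) (hBr : ∀ s, (B s).map conj = B s)
    (hCr : ∀ s, (C s).map conj = C s)
    {x ξ : ℝ → n → ℂ}
    (hx' : ∀ s, HasDerivAt x ((B s)ᵀ *ᵥ x s + C s *ᵥ ξ s) s)
    (hξ' : ∀ s, HasDerivAt ξ (-(A s *ᵥ x s) - B s *ᵥ ξ s) s)
    (hx : ∀ s, x s ≠ 0)
    {M₀ : Matrix n n ℂ} (hM₀ : M₀ᵀ = M₀) (hM₀x : M₀ *ᵥ x 0 = ξ 0)
    (hker : ∀ f : n → ℂ, imForm M₀ f = 0 → ∃ z : ℂ, f = z • x 0) :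
    ∃ M : ℝ → Matrix n n ℂ, M 0 = M₀ ∧
      (∀ s, (M s)ᵀ = M s) ∧
      (∀ s, HasDerivAt M (-A s - B s * M s - M s * (B s)ᵀ - M s * C s * M s) s) ∧
      (∀ s, M s *ᵥ x s = ξ s) ∧
      (∀ s g, ∃ f : n → ℂ, imForm (M s) g = imForm M₀ f) ∧
      ((∀ f, 0 ≤ (imForm M₀ f).re) → ∀ s g, 0 ≤ (imForm (M s) g).re) ∧
      (∀ s g, imForm (M s) g = 0 → ∃ z : ℂ, g = z • x s) ∧
      (∀ s i k, HasDerivAt (fun σ ↦ M σ i k)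
        ((-A s - B s * M s - M s * (B s)ᵀ - M s * C s * M s) i k) s) ∧
      (∀ U : Set ℝ, IsOpen U → (∀ i k, ContDiffOn ℝ ∞ (fun t ↦ A t i k) U) →
        (∀ i k, ContDiffOn ℝ ∞ (fun t ↦ B t i k) U) → (∀ i k, ContDiffOn ℝ ∞ (fun t ↦ C t i k) U) →
        ∀ i k, ContDiffOn ℝ ∞ (fun t ↦ M t i k) U) := by
  -- the matrix solution with data `(1, M₀)`
  obtain ⟨J, V, hJ0, hV0, hJ, hV⟩ := exists_jacobi hAc hBc hCc 1 M₀
  -- transport of the velocity by uniqueness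
  have htr : ∀ t, J t *ᵥ x 0 = x t ∧ V t *ᵥ x 0 = ξ t := fun t ↦
    jacobi_mulVec_eq hAc hBc hCc hJ hV hJ0 hV0 hx' hξ' hM₀x t
  -- the algebraic–differential mechanism on `I = ℝ`
  have hR := fun s ↦ riccati_of_jacobi (n := n) convex_univ (mem_univ 0)
    (fun s _ ↦ hA s) (fun s _ ↦ hC s) (fun s _ ↦ hAr s) (fun s _ ↦ hBr s) (fun s _ ↦ hCr s)
    (fun s _ ↦ (hJ s).hasDerivWithinAt) (fun s _ ↦ (hV s).hasDerivWithinAt) hJ0 hV0 hM₀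
    (fun s _ ↦ hx s) (fun s _ ↦ (htr s).1) (fun s _ ↦ (htr s).2) hker (mem_univ s)
  set M : ℝ → Matrix n n ℂ := fun t ↦ V t * (J t)⁻¹ with hM_def
  have hder : ∀ s, HasDerivAt M (-A s - B s * M s - M s * (B s)ᵀ - M s * C s * M s) s :=
    fun s ↦ (hR s).2.2.1.hasDerivAt univ_mem
  refine ⟨M, ?_, fun s ↦ (hR s).2.1, hder, fun s ↦ (hR s).2.2.2.1, fun s g ↦ ?_, fun hpos s g ↦ ?_,
    fun s g hg ↦ ?_, fun s i k ↦ hasDerivAt_entry (hder s) i k, fun U hU hA' hB' hC' i k ↦ ?_⟩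
  · -- initial value
    simp only [hM_def, hJ0, hV0, inv_one, Matrix.mul_one]
  · -- values of the imaginary part
    exact ⟨(J s)⁻¹ *ᵥ g, imForm_eq_imForm_inv_mulVec (hR s).1 (hR s).2.2.2.2 g⟩
  · -- non-negativity
    rw [imForm_eq_imForm_inv_mulVec (hR s).1 (hR s).2.2.2.2 g]
    exact hpos _
  · -- kernel
    exact exists_eq_smul_of_imForm_eq_zero (hR s).1 (hR s).2.2.2.2 hker (htr s).1 hg
  · -- smoothness of the entries
    exact contDiffOn_entry (contDiffOn_mul_inv hJ hV hU hA' hB' hC' fun t _ ↦ (hR t).1) i k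

/-- **The bundled construction on an open interval.** As `exists_riccati`, but the velocity
`x(s)` is only required to be nonzero on an open interval `I ∋ 0` (the coefficients and the
vector solution still being given on all of `ℝ`, e.g. extended from a compact sub-interval), and
all conclusions are drawn on `I`: there `M = V J⁻¹` is symmetric, solves the Riccati equation,
transports `x ↦ ξ`, has `imForm` with the values of `imForm M₀`, non-negative if `imForm M₀` is,
with kernel `ℂ x(s)`, and `C^∞` entries on open subsets of `I` where the coefficients are `C^∞`.
This is the form used along a geodesic read in a chart over a bounded range of its time
coordinate. [cite: Sbierski2015, §3 (3.3), (3.9), (3.12); arXiv v2 §2.2 pp. 12–14] -/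
theorem exists_riccati_on {I : Set ℝ} (hIo : IsOpen I) (hIc : Convex ℝ I) (h0 : (0 : ℝ) ∈ I)
    {A B C : ℝ → Matrix n n ℂ} (hAc : Continuous A) (hBc : Continuous B)
    (hCc : Continuous C) (hA : ∀ s, (A s)ᵀ = A s) (hC : ∀ s, (C s)ᵀ = C s)
    (hAr : ∀ s, (A s).map conj = A s) (hBr : ∀ s, (B s).map conj = B s)
    (hCr : ∀ s, (C s).map conj = C s)
    {x ξ : ℝ → n → ℂ}
    (hx' : ∀ s, HasDerivAt x ((B s)ᵀ *ᵥ x s + C s *ᵥ ξ s) s)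
    (hξ' : ∀ s, HasDerivAt ξ (-(A s *ᵥ x s) - B s *ᵥ ξ s) s)
    (hx : ∀ s ∈ I, x s ≠ 0)
    {M₀ : Matrix n n ℂ} (hM₀ : M₀ᵀ = M₀) (hM₀x : M₀ *ᵥ x 0 = ξ 0)
    (hker : ∀ f : n → ℂ, imForm M₀ f = 0 → ∃ z : ℂ, f = z • x 0) :
    ∃ M : ℝ → Matrix n n ℂ, M 0 = M₀ ∧
      (∀ s ∈ I, (M s)ᵀ = M s) ∧
      (∀ s ∈ I, HasDerivAt M (-A s - B s * M s - M s * (B s)ᵀ - M s * C s * M s) s) ∧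
      (∀ s ∈ I, M s *ᵥ x s = ξ s) ∧
      (∀ s ∈ I, ∀ g, ∃ f : n → ℂ, imForm (M s) g = imForm M₀ f) ∧
      ((∀ f, 0 ≤ (imForm M₀ f).re) → ∀ s ∈ I, ∀ g, 0 ≤ (imForm (M s) g).re) ∧
      (∀ s ∈ I, ∀ g, imForm (M s) g = 0 → ∃ z : ℂ, g = z • x s) ∧
      (∀ s ∈ I, ∀ i k, HasDerivAt (fun σ ↦ M σ i k)
        ((-A s - B s * M s - M s * (B s)ᵀ - M s * C s * M s) i k) s) ∧
      (∀ U : Set ℝ, IsOpen U → U ⊆ I → (∀ i k, ContDiffOn ℝ ∞ (fun t ↦ A t i k) U) →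
        (∀ i k, ContDiffOn ℝ ∞ (fun t ↦ B t i k) U) → (∀ i k, ContDiffOn ℝ ∞ (fun t ↦ C t i k) U) →
        ∀ i k, ContDiffOn ℝ ∞ (fun t ↦ M t i k) U) := by
  -- the matrix solution with data `(1, M₀)`
  obtain ⟨J, V, hJ0, hV0, hJ, hV⟩ := exists_jacobi hAc hBc hCc 1 M₀
  -- transport of the velocity by uniqueness
  have htr : ∀ t, J t *ᵥ x 0 = x t ∧ V t *ᵥ x 0 = ξ t := fun t ↦
    jacobi_mulVec_eq hAc hBc hCc hJ hV hJ0 hV0 hx' hξ' hM₀x t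
  -- the algebraic–differential mechanism on `I`
  have hR := fun s (hs : s ∈ I) ↦ riccati_of_jacobi (n := n) hIc h0
    (fun s _ ↦ hA s) (fun s _ ↦ hC s) (fun s _ ↦ hAr s) (fun s _ ↦ hBr s) (fun s _ ↦ hCr s)
    (fun s _ ↦ (hJ s).hasDerivWithinAt) (fun s _ ↦ (hV s).hasDerivWithinAt) hJ0 hV0 hM₀
    hx (fun s _ ↦ (htr s).1) (fun s _ ↦ (htr s).2) hker hs
  set M : ℝ → Matrix n n ℂ := fun t ↦ V t * (J t)⁻¹ with hM_def
  have hder : ∀ s ∈ I, HasDerivAt M (-A s - B s * M s - M s * (B s)ᵀ - M s * C s * M s) s :=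
    fun s hs ↦ (hR s hs).2.2.1.hasDerivAt (hIo.mem_nhds hs)
  refine ⟨M, ?_, fun s hs ↦ (hR s hs).2.1, hder, fun s hs ↦ (hR s hs).2.2.2.1, fun s hs g ↦ ?_,
    fun hpos s hs g ↦ ?_, fun s hs g hg ↦ ?_, fun s hs i k ↦ hasDerivAt_entry (hder s hs) i k,
    fun U hU hUI hA' hB' hC' i k ↦ ?_⟩
  · -- initial value
    simp only [hM_def, hJ0, hV0, inv_one, Matrix.mul_one]
  · -- values of the imaginary part
    exact ⟨(J s)⁻¹ *ᵥ g, imForm_eq_imForm_inv_mulVec (hR s hs).1 (hR s hs).2.2.2.2 g⟩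
  · -- non-negativity
    rw [imForm_eq_imForm_inv_mulVec (hR s hs).1 (hR s hs).2.2.2.2 g]
    exact hpos _
  · -- kernel
    exact exists_eq_smul_of_imForm_eq_zero (hR s hs).1 (hR s hs).2.2.2.2 hker (htr s).1 hg
  · -- smoothness of the entries
    exact contDiffOn_entry (contDiffOn_mul_inv hJ hV hU hA' hB' hC' fun t ht ↦ (hR t (hUI ht)).1) i k

end GaussianBeamRiccati

end Literature.Analysis.ODE

end
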